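import Summits.CriticalPhenomena.PercolationContinuityZ3.Theorems.PercMonotoneFactorsNoJumpOfLocalUniqueness
import Summits.CriticalPhenomena.PercolationContinuityZ3.Theorems.PercMonotoneFactorsLocalUniquenessCriterion
import HarnessLib

/-!
# Route `PercMonotoneFactors`, crux `ClassNoJump` (stmt-CriticalPhenomena-4488) — the mesoscopic split

Closes item `ClassNoJumpOfMesoscopic` (stmt-CriticalPhenomena-18242) and supports stmt-CriticalPhenomena-4488.

BC2-redirect decomposition of the deciding crux `ClassNoJump` into two class-wide statements at
the MESOSCOPIC scale `m = ⌊√n⌋ + 1` (`1 ≪ m ≪ n`):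

* `MesoscopicGluing`  — wherever a class member percolates, with probability `→ 1` any two
  `n`-far-connected points of `Λ_{2n}` at sup-distance `≤ 3m` are joined inside `Λ_{6n}`
  (CLOSE large clusters glue);
* `MesoscopicDensity` — wherever a class member percolates, with probability `→ 1` every point of
  `Λ_{2n}` lies within sup-distance `m` of an `n`-far-connected point of `Λ_{2n}`
  (large clusters leave NO MESOSCOPIC HOLES).

Assembly (this file): a deterministic CHAINING argument — between two far-connected points
`u, u'` of `Λ_{2n}` run the lattice staircase `v₀ = u, …, v_L = u'` inside `Λ_{2n}` (unit
steps); density supplies an `n`-far-connected representative `r_j ∈ Λ_{2n}` within `m` of each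
`v_j`; consecutive representatives are within `m + 1 + m ≤ 3m`, so gluing joins them inside
`Λ_{6n}`, and transitivity of `{· ⟷ · in Λ_{6n}}` joins `u` to `u'`; density at `v = 0` supplies
a far-connected point of `Λ_m ⊆ Λ_n` (`m ≤ n` for `n ≥ 2`).  Hence
`{density} ∩ {gluing} ⊆ V_n`, the union bound (the gluing event is a local, hence measurable,
event) gives `μ_t^F(V_n) ≥ μ_t^F(density) + μ_t^F(gluing) - 1 → 1`, i.e.
`PercolationForcesLocalUniqueness`; the landed glue `NoJumpOfLocalUniqueness_proof` and the
proved criterion `LocalUniquenessCriterion_proof` then give `ClassNoJump`.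
-/

noncomputable section

namespace Summit.CriticalPhenomena.PercolationContinuityZ3.Theorems

open MeasureTheory Filter Topology Set
open Literature.Probability.Percolation Literature.Probability.LatticeModels

namespace PercMonotoneFactorsClassNoJumpSplit

/-! ### `{x ⟷ y in S}` is an equivalence-type relation -/

/-- Transitivity of open connection inside `S`. [folklore] -/
theorem openConnIn_trans' {V : Type*} {S : Set V} {x y z : V} {ω : BondConfig V}
    (hxy : ω ∈ openConnIn S x y) (hyz : ω ∈ openConnIn S y z) : ω ∈ openConnIn S x z := by
  obtain ⟨hx, hy, hxy⟩ := hxy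
  obtain ⟨hy', hz, hyz⟩ := hyz
  exact ⟨hx, hz, hxy.trans hyz⟩

/-! ### Abstract chaining along a staircase -/

section Chain

variable {FC : Site 3 → Prop} {B : Site 3 → Prop} {Reach : Site 3 → Site 3 → Prop} {m : ℤ}

/-- **Chaining.** Let `B` be a region, `FC` a property of points ("far-connected") and `Reach`
a transitive relation such that (gluing) two `FC`-points of `B` at sup-distance `≤ 3m` are
related and (density) every point of `B` has an `FC`-point of `B` within sup-distance `m`,
`m ≥ 1`.  If `a, b` are `FC`-points of `B` within `m` of the two ends of a staircase
`v₀, …, v_L` of points of `B` with unit steps, then `Reach a b`. [folklore] -/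
theorem reach_of_staircase
    (htrans : ∀ a b c, Reach a b → Reach b c → Reach a c)
    (hglue : ∀ a b, B a → B b → (∀ i, |a i - b i| ≤ 3 * m) → FC a → FC b → Reach a b)
    (hdense : ∀ v, B v → ∃ r, (∀ i, |r i - v i| ≤ m) ∧ B r ∧ FC r)
    (hm : 1 ≤ m) :
    ∀ (L : ℕ) (v : ℕ → Site 3) (a : Site 3), B a → FC a → (∀ i, |a i - v 0 i| ≤ m) →
      (∀ j ≤ L, B (v j)) → (∀ j < L, ∀ i, |v j i - v (j + 1) i| ≤ 1) →
      ∀ b, B b → FC b → (∀ i, |b i - v L i| ≤ m) → Reach a b := by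
  intro L
  induction L with
  | zero =>
    intro v a hBa hFa ha _ _ b hBb hFb hb
    refine hglue a b hBa hBb (fun i => ?_) hFa hFb
    calc |a i - b i| ≤ |a i - v 0 i| + |v 0 i - b i| := abs_sub_le _ _ _
      _ ≤ m + m := add_le_add (ha i) (by rw [abs_sub_comm]; exact hb i)
      _ ≤ 3 * m := by linarith
  | succ L ih =>
    intro v a hBa hFa ha hBv hstep b hBb hFb hb
    obtain ⟨r, hr, hBr, hFr⟩ := hdense (v 1) (hBv 1 (by omega))
    have har : Reach a r := by
      refine hglue a r hBa hBr (fun i => ?_) hFa hFr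
      have h1 := ha i
      have h2 := hstep 0 (by omega) i
      have h3 := hr i
      calc |a i - r i| ≤ |a i - v 1 i| + |v 1 i - r i| := abs_sub_le _ _ _
        _ ≤ (|a i - v 0 i| + |v 0 i - v (0 + 1) i|) + |v 1 i - r i| :=
            add_le_add (abs_sub_le _ _ _) le_rfl
        _ ≤ (m + 1) + m := by
            refine add_le_add (add_le_add h1 h2) ?_
            rw [abs_sub_comm]; exact h3
        _ ≤ 3 * m := by linarith
    refine htrans a r b har ?_
    refine ih (fun j => v (j + 1)) r hBr hFr hr (fun j hj => hBv (j + 1) (by omega))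
      (fun j hj i => hstep (j + 1) (by omega) i) b hBb hFb ?_
    simpa using hb

end Chain

/-! ### The staircase between two points of the cube `Λ_{2n}` -/

/-- One coordinate of the staircase: `e(j) = a + sign(δ) · min(j, |δ|)`, `δ = b - a`, moves from
`a` (`j = 0`) to `b` (`j ≥ |δ|`) by steps of size `≤ 1`, staying between `a` and `b`. [folklore] -/
theorem staircase_coord (a b N : ℤ) (ha : |a| ≤ N) (hb : |b| ≤ N) (j : ℕ) :
    abs (a + Int.sign (b - a) * min (j : ℤ) (abs (b - a))) ≤ N ∧
    abs ((a + Int.sign (b - a) * min (j : ℤ) (abs (b - a))) -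
        (a + Int.sign (b - a) * min ((j : ℤ) + 1) (abs (b - a)))) ≤ 1 := by
  have h1 := abs_le.1 ha
  have h2 := abs_le.1 hb
  have hj0 : (0 : ℤ) ≤ j := by positivity
  set A := |b - a| with hA
  have hA0 : 0 ≤ A := abs_nonneg _
  have hmin0 : 0 ≤ min (j : ℤ) A := le_min hj0 hA0
  have hminle : min (j : ℤ) A ≤ A := min_le_right _ _
  -- the increment `min (j+1) A - min j A ∈ [0, 1]`
  have hd : 0 ≤ min ((j : ℤ) + 1) A - min (j : ℤ) A ∧ min ((j : ℤ) + 1) A - min (j : ℤ) A ≤ 1 := by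
    rcases le_or_gt ((j : ℤ) + 1) A with h | h
    · rw [min_eq_left h, min_eq_left (by linarith)]
      constructor <;> linarith
    · rw [min_eq_right h.le]
      rcases le_or_gt A (j : ℤ) with h' | h'
      · rw [min_eq_right h']; constructor <;> linarith
      · rw [min_eq_left h'.le]; constructor <;> linarith
  rcases lt_trichotomy (b - a) 0 with hneg | hzero | hpos
  · have hs : Int.sign (b - a) = -1 := Int.sign_eq_neg_one_of_neg hneg
    have hAeq : A = -(b - a) := by rw [hA, abs_of_neg hneg]
    rw [hs]
    constructor
    · rw [abs_le]; constructor <;> nlinarith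
    · have : a + -1 * min (j : ℤ) A - (a + -1 * min ((j : ℤ) + 1) A) =
          min ((j : ℤ) + 1) A - min (j : ℤ) A := by ring
      rw [this, abs_of_nonneg hd.1]; exact hd.2
  · have hs : Int.sign (b - a) = 0 := by rw [hzero, Int.sign_zero]
    rw [hs]
    constructor
    · simpa using ha
    · simp
  · have hs : Int.sign (b - a) = 1 := Int.sign_eq_one_of_pos hpos
    have hAeq : A = b - a := by rw [hA, abs_of_pos hpos]
    rw [hs]
    constructor
    · rw [abs_le]; constructor <;> nlinarith
    · have : a + 1 * min (j : ℤ) A - (a + 1 * min ((j : ℤ) + 1) A) =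
          -(min ((j : ℤ) + 1) A - min (j : ℤ) A) := by ring
      rw [this, abs_neg, abs_of_nonneg hd.1]; exact hd.2

/-- The staircase from `u` towards `u'`: after `j` steps every coordinate has moved `min(j, |δᵢ|)`
towards `u'ᵢ`, `δ = u' - u`; it starts at `u`, reaches `u'`, stays in the cube `Λ_N` containing
`u, u'` and has unit steps. [folklore] -/
theorem staircase_exists (N : ℤ) (u u' : Site 3) (hu : ∀ i, |u i| ≤ N) (hu' : ∀ i, |u' i| ≤ N) :
    ∃ v : ℕ → Site 3, v 0 = u ∧ (∀ j : ℕ, (∀ i, |u' i - u i| ≤ (j : ℤ)) → v j = u') ∧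
      (∀ j, ∀ i, |v j i| ≤ N) ∧ (∀ j, ∀ i, |v j i - v (j + 1) i| ≤ 1) := by
  refine ⟨fun j i => u i + Int.sign (u' i - u i) * min (j : ℤ) |u' i - u i|, ?_, ?_, ?_, ?_⟩
  · funext i
    simp
  · intro j hj
    funext i
    have hmin : min (j : ℤ) |u' i - u i| = |u' i - u i| := min_eq_right (hj i)
    simp only [hmin, Int.sign_mul_abs]
    ring
  · intro j i
    exact (staircase_coord (u i) (u' i) N (hu i) (hu' i) j).1
  · intro j i
    have := (staircase_coord (u i) (u' i) N (hu i) (hu' i) j).2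
    simpa only [Nat.cast_add, Nat.cast_one] using this

/-! ### The deterministic inclusion `{density} ∩ {gluing} ⊆ V_n` -/

/-- **Local uniqueness from mesoscopic density and gluing (deterministic).** Fix an output
configuration `ω`, a scale `n` and a mesoscopic scale `1 ≤ m ≤ n`.  If every point of `Λ_{2n}`
is within `m` of an `n`-far-connected point of `Λ_{2n}` (density) and any two `n`-far-connected
points of `Λ_{2n}` at sup-distance `≤ 3m` are joined inside `Λ_{6n}` (gluing), then `ω ∈ V_n`:
some point of `Λ_n` is `n`-far-connected and all `n`-far-connected points of `Λ_{2n}` are joined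
inside `Λ_{6n}`. [folklore] -/
theorem VEvent_of_density_of_gluing (ω : BondConfig (Site 3)) (n : ℕ) (m : ℤ) (hm1 : 1 ≤ m)
    (hmn : m ≤ (n : ℤ))
    (hdense : ∀ v : Site 3, (∀ i, |v i| ≤ 2 * (n : ℤ)) → ∃ u : Site 3,
      (∀ i, |u i - v i| ≤ m) ∧ (∀ i, |u i| ≤ 2 * (n : ℤ)) ∧
      (∃ y : Site 3, (∃ i, |y i - u i| = (n : ℤ)) ∧
        ω ∈ openConnIn {z : Site 3 | ∀ i, |z i - u i| ≤ (n : ℤ)} u y))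
    (hglue : ∀ u u' : Site 3, (∀ i, |u i| ≤ 2 * (n : ℤ)) → (∀ i, |u' i| ≤ 2 * (n : ℤ)) →
      (∀ i, |u i - u' i| ≤ 3 * m) →
      (∃ y : Site 3, (∃ i, |y i - u i| = (n : ℤ)) ∧
        ω ∈ openConnIn {z : Site 3 | ∀ i, |z i - u i| ≤ (n : ℤ)} u y) →
      (∃ y : Site 3, (∃ i, |y i - u' i| = (n : ℤ)) ∧
        ω ∈ openConnIn {z : Site 3 | ∀ i, |z i - u' i| ≤ (n : ℤ)} u' y) →
      ω ∈ openConnIn {z : Site 3 | ∀ i, |z i| ≤ 6 * (n : ℤ)} u u') :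
    (∃ u : Site 3, (∀ i, |u i| ≤ (n : ℤ)) ∧ (∃ y : Site 3, (∃ i, |y i - u i| = (n : ℤ)) ∧
        ω ∈ openConnIn {z : Site 3 | ∀ i, |z i - u i| ≤ (n : ℤ)} u y)) ∧
    (∀ u u' : Site 3, (∀ i, |u i| ≤ 2 * (n : ℤ)) → (∀ i, |u' i| ≤ 2 * (n : ℤ)) →
      (∃ y : Site 3, (∃ i, |y i - u i| = (n : ℤ)) ∧
        ω ∈ openConnIn {z : Site 3 | ∀ i, |z i - u i| ≤ (n : ℤ)} u y) →
      (∃ y : Site 3, (∃ i, |y i - u' i| = (n : ℤ)) ∧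
        ω ∈ openConnIn {z : Site 3 | ∀ i, |z i - u' i| ≤ (n : ℤ)} u' y) →
      ω ∈ openConnIn {z : Site 3 | ∀ i, |z i| ≤ 6 * (n : ℤ)} u u') := by
  constructor
  · -- existence: the representative of the origin lies in `Λ_m ⊆ Λ_n`
    obtain ⟨u, hu, -, hFC⟩ := hdense 0 (fun i => by simp)
    exact ⟨u, fun i => by simpa using (hu i).trans hmn, hFC⟩
  · intro u u' hu hu' hFu hFu'
    obtain ⟨v, hv0, hvL, hvB, hvstep⟩ := staircase_exists (2 * (n : ℤ)) u u' hu hu'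
    have hm0 : (0 : ℤ) ≤ m := by linarith
    refine reach_of_staircase (FC := fun w => ∃ y : Site 3, (∃ i, |y i - w i| = (n : ℤ)) ∧
        ω ∈ openConnIn {z : Site 3 | ∀ i, |z i - w i| ≤ (n : ℤ)} w y)
      (B := fun w => ∀ i, |w i| ≤ 2 * (n : ℤ))
      (Reach := fun a b => ω ∈ openConnIn {z : Site 3 | ∀ i, |z i| ≤ 6 * (n : ℤ)} a b)
      (m := m) (fun a b c => openConnIn_trans') hglue hdense hm1 (4 * n) v u hu hFu
      (fun i => by rw [hv0]; simpa using hm0) (fun j _ => hvB j) (fun j _ => hvstep j)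
      u' hu' hFu' (fun i => ?_)
    have hL : v (4 * n) = u' := by
      refine hvL (4 * n) fun i => ?_
      have h1 := abs_le.1 (hu i)
      have h2 := abs_le.1 (hu' i)
      rw [abs_le]; push_cast; constructor <;> linarith
    rw [hL]; simpa using hm0


/-! ### The gluing event is local, hence measurable -/

/-- The mesoscopic gluing event at scale `n` (gluing range `3m`) is determined by the pairs of the
cube `Λ_{6n}`: every connection event in it lives in a cube `Λ_n(u) ⊆ Λ_{3n}` or in `Λ_{6n}`
(as for the route's event `V_n`, `determinedBy_VEvent`). [folklore] -/
theorem determinedBy_gluingEvent (n : ℕ) (m : ℤ) :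
    DeterminedBy {ω : BondConfig (Site 3) | ∀ u u' : Site 3, (∀ i, |u i| ≤ 2 * (n : ℤ)) → (∀ i, |u' i| ≤ 2 * (n : ℤ)) → (∀ i, |u i - u' i| ≤ 3 * m) → (∃ y : Site 3, (∃ i, |y i - u i| = (n : ℤ)) ∧ ω ∈ openConnIn {z : Site 3 | ∀ i, |z i - u i| ≤ (n : ℤ)} u y) → (∃ y : Site 3, (∃ i, |y i - u' i| = (n : ℤ)) ∧ ω ∈ openConnIn {z : Site 3 | ∀ i, |z i - u' i| ≤ (n : ℤ)} u' y) → ω ∈ openConnIn {z : Site 3 | ∀ i, |z i| ≤ 6 * (n : ℤ)} u u'}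
      {z : Site 3 | ∀ i, |z i| ≤ 6 * (n : ℤ)}.sym2 := by
  rw [determinedBy_iff]
  intro ω ω' h
  have hsub : ∀ u : Site 3, (∀ i, |u i| ≤ 2 * (n : ℤ)) →
      {z : Site 3 | ∀ i, |z i - u i| ≤ (n : ℤ)}.sym2 ⊆ {z : Site 3 | ∀ i, |z i| ≤ 6 * (n : ℤ)}.sym2 := by
    intro u hu e he
    rw [Set.mem_sym2_iff_subset] at he ⊢
    intro z hz
    have h1 : ∀ i, |z i - u i| ≤ (n : ℤ) := he hz
    show ∀ i, |z i| ≤ 6 * (n : ℤ)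
    intro i
    have h1 := h1 i
    have h2 := hu i
    have hn0 : (0 : ℤ) ≤ n := Int.natCast_nonneg n
    rw [abs_le] at h1 h2 ⊢
    constructor <;> linarith [h1.1, h1.2, h2.1, h2.2]
  have hiff : ∀ u : Site 3, (∀ i, |u i| ≤ 2 * (n : ℤ)) → ∀ y : Site 3,
      (ω ∈ openConnIn {z : Site 3 | ∀ i, |z i - u i| ≤ (n : ℤ)} u y ↔
        ω' ∈ openConnIn {z : Site 3 | ∀ i, |z i - u i| ≤ (n : ℤ)} u y) :=
    fun u hu y => (determinedBy_iff _ _).1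
      (DCT16.determinedBy_openConnIn _ u y (hsub u hu)) ω ω' h
  have hiff6 : ∀ u u' : Site 3,
      (ω ∈ openConnIn {z : Site 3 | ∀ i, |z i| ≤ 6 * (n : ℤ)} u u' ↔
        ω' ∈ openConnIn {z : Site 3 | ∀ i, |z i| ≤ 6 * (n : ℤ)} u u') :=
    fun u u' => (determinedBy_iff _ _).1
      (DCT16.determinedBy_openConnIn _ u u' subset_rfl) ω ω' h
  simp only [Set.mem_setOf_eq]
  exact forall_congr' fun u => forall_congr' fun u' =>
    imp_congr_right fun hu => imp_congr_right fun hu' => imp_congr_right fun _ =>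
      imp_congr (exists_congr fun y => and_congr_right fun _ => hiff u hu y)
        (imp_congr (exists_congr fun y => and_congr_right fun _ => hiff u' hu' y) (hiff6 u u'))

/-- The mesoscopic gluing event is measurable (a local event). [folklore] -/
theorem measurableSet_gluingEvent (n : ℕ) (m : ℤ) :
    MeasurableSet {ω : BondConfig (Site 3) | ∀ u u' : Site 3, (∀ i, |u i| ≤ 2 * (n : ℤ)) → (∀ i, |u' i| ≤ 2 * (n : ℤ)) → (∀ i, |u i - u' i| ≤ 3 * m) → (∃ y : Site 3, (∃ i, |y i - u i| = (n : ℤ)) ∧ ω ∈ openConnIn {z : Site 3 | ∀ i, |z i - u i| ≤ (n : ℤ)} u y) → (∃ y : Site 3, (∃ i, |y i - u' i| = (n : ℤ)) ∧ ω ∈ openConnIn {z : Site 3 | ∀ i, |z i - u' i| ≤ (n : ℤ)} u' y) → ω ∈ openConnIn {z : Site 3 | ∀ i, |z i| ≤ 6 * (n : ℤ)} u u'} := by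
  classical
  have hSfin : ({z : Site 3 | ∀ i, |z i| ≤ 6 * (n : ℤ)}).Finite :=
    PercMonotoneFactorsNoJumpOfLocalUniqueness.finite_cube _
  have h' : DeterminedBy {ω : BondConfig (Site 3) | ∀ u u' : Site 3, (∀ i, |u i| ≤ 2 * (n : ℤ)) → (∀ i, |u' i| ≤ 2 * (n : ℤ)) → (∀ i, |u i - u' i| ≤ 3 * m) → (∃ y : Site 3, (∃ i, |y i - u i| = (n : ℤ)) ∧ ω ∈ openConnIn {z : Site 3 | ∀ i, |z i - u i| ≤ (n : ℤ)} u y) → (∃ y : Site 3, (∃ i, |y i - u' i| = (n : ℤ)) ∧ ω ∈ openConnIn {z : Site 3 | ∀ i, |z i - u' i| ≤ (n : ℤ)} u' y) → ω ∈ openConnIn {z : Site 3 | ∀ i, |z i| ≤ 6 * (n : ℤ)} u u'} ↑(hSfin.toFinset.sym2) := by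
    rw [Finset.coe_sym2, hSfin.coe_toFinset]
    exact determinedBy_gluingEvent n m
  exact h'.measurableSet_of_finset

/-! ### The union bound -/

/-- **Union bound / squeeze.** If `D_n ∩ G_n ⊆ V_n` eventually, `G_n` is measurable and
`μ(D_n) → 1`, `μ(G_n) → 1` for a probability measure `μ`, then `μ(V_n) → 1`, since
`μ(V_n) ≥ μ(D_n ∩ G_n) ≥ μ(D_n) + μ(G_n) - 1`. [folklore] -/
theorem tendsto_measureReal_of_inter_subset {X : Type*} [MeasurableSpace X] (μ : Measure X)
    [IsProbabilityMeasure μ] {D G V : ℕ → Set X} (hsub : ∀ᶠ n in atTop, D n ∩ G n ⊆ V n)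
    (hGm : ∀ n, MeasurableSet (G n)) (hD : Tendsto (fun n => μ.real (D n)) atTop (𝓝 1))
    (hG : Tendsto (fun n => μ.real (G n)) atTop (𝓝 1)) :
    Tendsto (fun n => μ.real (V n)) atTop (𝓝 1) := by
  have hlow : Tendsto (fun n => μ.real (D n) + μ.real (G n) - 1) atTop (𝓝 1) := by
    have := (hD.add hG).sub_const 1
    norm_num at this
    exact this
  refine tendsto_of_tendsto_of_tendsto_of_le_of_le' hlow tendsto_const_nhds ?_
    (Eventually.of_forall fun n => measureReal_le_one)
  filter_upwards [hsub] with n hn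
  have h1 : μ.real (D n ∩ G n) ≤ μ.real (V n) := measureReal_mono hn
  have h2 : μ.real (D n ∩ G n) + μ.real (D n \ G n) = μ.real (D n) :=
    measureReal_inter_add_sdiff (hGm n)
  have h3 : μ.real (D n \ G n) ≤ μ.real (G n)ᶜ := measureReal_mono (Set.sdiff_subset_compl _ _)
  have h4 : μ.real (G n)ᶜ = 1 - μ.real (G n) := by
    rw [measureReal_compl (hGm n), probReal_univ]
  linarith

end PercMonotoneFactorsClassNoJumpSplit

open PercMonotoneFactorsClassNoJumpSplit
  Summit.CriticalPhenomena.PercolationContinuityZ3.Theses.PercMonotoneFactors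

/-- **Mesoscopic gluing and mesoscopic density force local uniqueness.** For every admissible
rule `F` and every percolating `t`: if close (`≤ 3m`, `m = ⌊√n⌋+1`) `n`-far-connected points of
`Λ_{2n}` glue inside `Λ_{6n}` with probability `→ 1`, and every point of `Λ_{2n}` is `m`-close to
an `n`-far-connected point of `Λ_{2n}` with probability `→ 1`, then `μ_t^F(V_n) → 1` — the
route's crux `PercolationForcesLocalUniqueness`. Deterministic chaining
(`VEvent_of_density_of_gluing`) plus the union bound. [cite: DuminilcopinKozmaTassion2020, §1.1 Example 1] -/
theorem PercolationForcesLocalUniqueness_of_mesoscopic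
    (hG : ∀ (R : ℕ) (F : BondConfig (Site 3) → BondConfig (Site 3)), Measurable F → Monotone F → F ∅ = ∅ → F (zdGraph 3).edgeSet = (zdGraph 3).edgeSet → (∀ ω : BondConfig (Site 3), ω ⊆ (zdGraph 3).edgeSet → F ω ⊆ (zdGraph 3).edgeSet) → (∀ (φ : zdGraph 3 ≃g zdGraph 3) (ω : BondConfig (Site 3)), F (Sym2.map φ '' ω) = Sym2.map φ '' (F ω)) → (∀ (ω ω' : BondConfig (Site 3)) (e : Sym2 (Site 3)), (∀ e' : Sym2 (Site 3), (∃ x ∈ e, ∃ y ∈ e', ∀ i, |x i - y i| ≤ (R : ℤ)) → (e' ∈ ω ↔ e' ∈ ω')) → (e ∈ F ω ↔ e ∈ F ω')) → ∀ t : unitInterval, 0 < ((bondPercolation (zdGraph 3) t).map F).real (percolatesAt 0) → Filter.Tendsto (fun n : ℕ => ((bondPercolation (zdGraph 3) t).map F).real {ω : BondConfig (Site 3) | ∀ u u' : Site 3, (∀ i, |u i| ≤ 2 * (n : ℤ)) → (∀ i, |u' i| ≤ 2 * (n : ℤ)) → (∀ i, |u i - u' i| ≤ 3 * ((Nat.sqrt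 n + 1 : ℕ) : ℤ)) → (∃ y : Site 3, (∃ i, |y i - u i| = (n : ℤ)) ∧ ω ∈ openConnIn {z : Site 3 | ∀ i, |z i - u i| ≤ (n : ℤ)} u y) → (∃ y : Site 3, (∃ i, |y i - u' i| = (n : ℤ)) ∧ ω ∈ openConnIn {z : Site 3 | ∀ i, |z i - u' i| ≤ (n : ℤ)} u' y) → ω ∈ openConnIn {z : Site 3 | ∀ i, |z i| ≤ 6 * (n : ℤ)} u u'}) Filter.atTop (nhds 1))
    (hD : ∀ (R : ℕ) (F : BondConfig (Site 3) → BondConfig (Site 3)), Measurable F → Monotone F → F ∅ = ∅ → F (zdGraph 3).edgeSet = (zdGraph 3).edgeSet → (∀ ω : BondConfig (Site 3), ω ⊆ (zdGraph 3).edgeSet → F ω ⊆ (zdGraph 3).edgeSet) → (∀ (φ : zdGraph 3 ≃g zdGraph 3) (ω : BondConfig (Site 3)), F (Sym2.map φ '' ω) = Sym2.map φ '' (F ω)) → (∀ (ω ω' : BondConfig (Site 3)) (e : Sym2 (Site 3)), (∀ e' : Sym2 (Site 3), (∃ x ∈ e, ∃ y ∈ e', ∀ i, |x i - y i| ≤ (R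 : ℤ)) → (e' ∈ ω ↔ e' ∈ ω')) → (e ∈ F ω ↔ e ∈ F ω')) → ∀ t : unitInterval, 0 < ((bondPercolation (zdGraph 3) t).map F).real (percolatesAt 0) → Filter.Tendsto (fun n : ℕ => ((bondPercolation (zdGraph 3) t).map F).real {ω : BondConfig (Site 3) | ∀ v : Site 3, (∀ i, |v i| ≤ 2 * (n : ℤ)) → ∃ u : Site 3, (∀ i, |u i - v i| ≤ ((Nat.sqrt n + 1 : ℕ) : ℤ)) ∧ (∀ i, |u i| ≤ 2 * (n : ℤ)) ∧ (∃ y : Site 3, (∃ i, |y i - u i| = (n : ℤ)) ∧ ω ∈ openConnIn {z : Site 3 | ∀ i, |z i - u i| ≤ (n : ℤ)} u y)}) Filter.atTop (nhds 1)) :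
    PercolationForcesLocalUniqueness := by
  intro R F hFm hFmono hF0 hFE hFsub hFeq hloc t hpos
  have hG' := hG R F hFm hFmono hF0 hFE hFsub hFeq hloc t hpos
  have hD' := hD R F hFm hFmono hF0 hFE hFsub hFeq hloc t hpos
  haveI : IsProbabilityMeasure ((bondPercolation (zdGraph 3) t).map F) :=
    Measure.isProbabilityMeasure_map hFm.aemeasurable
  refine tendsto_measureReal_of_inter_subset ((bondPercolation (zdGraph 3) t).map F) ?_
    (fun n => measurableSet_gluingEvent n _) hD' hG'
  filter_upwards [eventually_ge_atTop 2] with n hn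
  rintro ω ⟨hωD, hωG⟩
  have hm1 : (1 : ℤ) ≤ ((Nat.sqrt n + 1 : ℕ) : ℤ) := by push_cast; linarith [Int.natCast_nonneg (Nat.sqrt n)]
  have hmn : ((Nat.sqrt n + 1 : ℕ) : ℤ) ≤ (n : ℤ) := by
    exact_mod_cast (Nat.sqrt_lt_self hn : Nat.sqrt n + 1 ≤ n)
  exact VEvent_of_density_of_gluing ω n _ hm1 hmn hωD hωG

/-- **The mesoscopic split of `ClassNoJump`** (BC2 redirect of the deciding crux
stmt-CriticalPhenomena-4488): `MesoscopicGluing → MesoscopicDensity → ClassNoJump`, through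
`PercolationForcesLocalUniqueness_of_mesoscopic`, the landed glue `NoJumpOfLocalUniqueness_proof`
and the proved criterion `LocalUniquenessCriterion_proof`. [cite: DuminilcopinKozmaTassion2020, §1.1 scheme (⋆)] -/
theorem ClassNoJump_of_mesoscopic
    (hG : ∀ (R : ℕ) (F : BondConfig (Site 3) → BondConfig (Site 3)), Measurable F → Monotone F → F ∅ = ∅ → F (zdGraph 3).edgeSet = (zdGraph 3).edgeSet → (∀ ω : BondConfig (Site 3), ω ⊆ (zdGraph 3).edgeSet → F ω ⊆ (zdGraph 3).edgeSet) → (∀ (φ : zdGraph 3 ≃g zdGraph 3) (ω : BondConfig (Site 3)), F (Sym2.map φ '' ω) = Sym2.map φ '' (F ω)) → (∀ (ω ω' : BondConfig (Site 3)) (e : Sym2 (Site 3)), (∀ e' : Sym2 (Site 3), (∃ x ∈ e, ∃ y ∈ e', ∀ i, |x i - y i| ≤ (R : ℤ)) → (e' ∈ ω ↔ e' ∈ ω')) → (e ∈ F ω ↔ e ∈ F ω')) → ∀ t : unitInterval, 0 < ((bondPercolation (zdGraph 3) t).map F).real (percolatesAt 0) → Filter.Tendsto (fun n : ℕ => ((bondPercolation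 (zdGraph 3) t).map F).real {ω : BondConfig (Site 3) | ∀ u u' : Site 3, (∀ i, |u i| ≤ 2 * (n : ℤ)) → (∀ i, |u' i| ≤ 2 * (n : ℤ)) → (∀ i, |u i - u' i| ≤ 3 * ((Nat.sqrt n + 1 : ℕ) : ℤ)) → (∃ y : Site 3, (∃ i, |y i - u i| = (n : ℤ)) ∧ ω ∈ openConnIn {z : Site 3 | ∀ i, |z i - u i| ≤ (n : ℤ)} u y) → (∃ y : Site 3, (∃ i, |y i - u' i| = (n : ℤ)) ∧ ω ∈ openConnIn {z : Site 3 | ∀ i, |z i - u' i| ≤ (n : ℤ)} u' y) → ω ∈ openConnIn {z : Site 3 | ∀ i, |z i| ≤ 6 * (n : ℤ)} u u'}) Filter.atTop (nhds 1))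
    (hD : ∀ (R : ℕ) (F : BondConfig (Site 3) → BondConfig (Site 3)), Measurable F → Monotone F → F ∅ = ∅ → F (zdGraph 3).edgeSet = (zdGraph 3).edgeSet → (∀ ω : BondConfig (Site 3), ω ⊆ (zdGraph 3).edgeSet → F ω ⊆ (zdGraph 3).edgeSet) → (∀ (φ : zdGraph 3 ≃g zdGraph 3) (ω : BondConfig (Site 3)), F (Sym2.map φ '' ω) = Sym2.map φ '' (F ω)) → (∀ (ω ω' : BondConfig (Site 3)) (e : Sym2 (Site 3)), (∀ e' : Sym2 (Site 3), (∃ x ∈ e, ∃ y ∈ e', ∀ i, |x i - y i| ≤ (R : ℤ)) → (e' ∈ ω ↔ e' ∈ ω')) → (e ∈ F ω ↔ e ∈ F ω')) → ∀ t : unitInterval, 0 < ((bondPercolation (zdGraph 3) t).map F).real (percolatesAt 0) → Filter.Tendsto (fun n : ℕ => ((bondPercolation (zdGraph 3) t).map F).real {ω : BondConfig (Site 3) | ∀ v : Site 3, (∀ i, |v i| ≤ 2 * (n : ℤ)) → ∃ u : Site 3, (∀ i, |u i - v i| ≤ ((Nat.sqrt n + 1 : ℕ) : ℤ)) ∧ (∀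 i, |u i| ≤ 2 * (n : ℤ)) ∧ (∃ y : Site 3, (∃ i, |y i - u i| = (n : ℤ)) ∧ ω ∈ openConnIn {z : Site 3 | ∀ i, |z i - u i| ≤ (n : ℤ)} u y)}) Filter.atTop (nhds 1)) :
    ClassNoJump :=
  (show PercolationForcesLocalUniqueness → LocalUniquenessCriterion → ClassNoJump from
    NoJumpOfLocalUniqueness_proof)
    (PercolationForcesLocalUniqueness_of_mesoscopic hG hD) LocalUniquenessCriterion_proof

/-- **Item `ClassNoJumpOfMesoscopic` (stmt-CriticalPhenomena-18242)** — the glue of the mesoscopic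
split, by name. [cite: DuminilcopinKozmaTassion2020, §1.1 scheme (⋆)] -/
theorem ClassNoJumpOfMesoscopic_proof : ClassNoJumpOfMesoscopic :=
  fun hG hD => ClassNoJump_of_mesoscopic hG hD

end Summit.CriticalPhenomena.PercolationContinuityZ3.Theorems
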